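import Summits.ResolutionOfSingularities.ResolutionOfSingularities.Theorems.FrobeniusClosingPatchingRelPerfectDepthSepCJSLoop
import Summits.ResolutionOfSingularities.ResolutionOfSingularities.Theorems.FrobeniusClosingPatchingRelPerfectDepthSepCJSEnd
import Summits.ResolutionOfSingularities.ResolutionOfSingularities.Theorems.FrobeniusClosingPatchingRelPerfectDepthWeightTwoBCJS
import Literature.AlgebraicGeometry.Resolution.EmbeddedResolutionExcellentSurfacesSequence
import Literature.AlgebraicGeometry.Resolution.RegularCentreComponents
import Literature.AlgebraicGeometry.Resolution.NormalCrossingsStrictification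
import Literature.AlgebraicGeometry.Resolution.MarkedIdealsEtale
import Literature.Topology.KrullDimensionDrop
import HarnessLib

/-!
# Crux `PatchingRelPerfect` (stmt-ResolutionOfSingularities-16161), chain W5.2 — F6 STAGE 2, target T6-E2 `SeparationBoundaryNil₃`:
# PHASE A «CJS ⇒ IsSepSeq» — the CJS INDUCTION and `SepPhaseA.phaseA`

[OURS · L1 W5.2 · TargetsF6 T6-E2 Phase A] NOT statements of the manuscript under review (Hironaka 2017); the named fact
`CossartJannsenSaito2020EmbeddedSequenceB` (CJS 2020 Thm. 1.4 / 6.9 (a), F-32bR, `B = ∅`) enters as a HYPOTHESIS of `phaseA`,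
exactly as in the target `DepthTargets.SeparationBoundaryNil₃` (res-L1-w52-plan-1 RULING R2a/R2b 10:19Z/10:36Z).

`SepCJS.cjs_transport`: along a sequence of complete `𝓑`-permissible blow-ups over `X = Supp 𝔟` (`IsBPermissibleSequenceB`,
starting boundary `∅`), the Phase-A state `SepCJS.StateA` is carried by a WEIGHT-ONE sequence `DepthTargets.IsSepSeq ρ 𝔟 [] 𝔟' 𝒟'`
(TargetsF6 §4, p523708) on a scheme `E'` ISOMORPHIC to CJS's `Z'` — the ISO-TOLERANT induction of T5-E's `WeightTwoB.cjs_transport`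
(res-D-pv-054, p520851): CJS steps with EMPTY centre are isomorphisms and are absorbed into `e : E' ≅ Z'`; a step with non-empty
centre `C` is re-sequenced along the connected pieces of `e^*C` (`SepCJS.pieces_loop`), the piece data coming from CJS's clauses:
regularity of the pieces of a regular centre, snc with the born traces by res-type-019's P3 pushed through `e`
(`WeightTwoB.hasSNCWith_comap_of_isNormalCrossingWith`), and ORD2 from «every point of the centre is a singular point of `X_j` or
lies on `B_j`» (`SepCJS.StateA.ord2_of_bsing`; the singular branch through the stalk isomorphism of `e` and `Ideal.quotientEquiv`,
the boundary branch through the carried COVER «`e⁻¹B_j` lies in the born traces»).  The END (`SepCJS.StateA.endData`, from CJS's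
end clauses `X₁` regular and `X₁ ⋔ B₁`) and `StateA.init` give **`SepPhaseA.phaseA`** — res-L1-w52-stub-1's Phase-A interface
VERBATIM (10:24:27Z), consumed by his `separationBoundaryNil₃_holds`.

AI-written; AI review is weaker than expert review.

## References
* V. Cossart, U. Jannsen, S. Saito, LNM 2270 (2020), Thm. 1.4, Cor. 1.5, Def. 4.1, (6.2), Thm. 6.9 (a), Def. 6.1 (2). [CossartJannsenSaito2020]
* E. Bierstone, D. Grigoriev, P. Milman, J. Włodarczyk, arXiv:1206.3090, Def. 3.1.3, §4 Step 2. [BierstoneGrigorievMilmanWlodarczyk2011]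
* J. Kollár, *Lectures on Resolution of Singularities* (2007), 3.30.2, (3.111) Steps 1–3. [Kollar2007]
-/

-- `Summit.<Summit>.<Sub>.Theorems` with `Sub = Summit` (single-conjunct summit, D-0017)
set_option linter.dupNamespace false

noncomputable section

open CategoryTheory CategoryTheory.Limits AlgebraicGeometry TopologicalSpace IsLocalRing
open Literature.AlgebraicGeometry.Resolution Scheme.IdealSheafData

namespace Summit.ResolutionOfSingularities.ResolutionOfSingularities.Theorems

universe u

namespace SepCJS

open DepthSNC DepthTargets WeightTwoB

/-! ## The CJS induction -/

/-- **Transport along the CJS sequence** (see the module docstring): ISO-TOLERANT induction over `IsBPermissibleSequenceB`.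
[cite: CossartJannsenSaito2020, Thm. 1.4, (6.2), Thm. 6.9 (a), Def. 4.1] [cite: Kollar2007, (3.111) Step 1] -/
theorem cjs_transport {E : Scheme.{u}} [IsIntegral E] [IsNoetherian E] (hE : Scheme.IsRegular E)
    (𝔟 : E.IdealSheafData) (h𝔟 : 𝔟 ≠ ⊥) (hlp : IsLocallyPrincipal 𝔟) :
    ∀ {Z' : Scheme.{u}} {σ : Z' ⟶ E} {X' B' : Set Z'},
      IsBPermissibleSequenceB (𝔟.support : Set E) (∅ : Set E) σ X' B' →
      IsClosed X' ∧ ∃ (E' : Scheme.{u}) (_ : IsIntegral E') (_ : IsNoetherian E') (_ : IsNoetherian Z') (ρ : E' ⟶ E)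
        (e : E' ≅ Z') (𝔟' H' : E'.IdealSheafData) (ℬ' 𝒟' : List (E'.IdealSheafData × ℕ)),
        IsSepSeq ρ 𝔟 ([] : List (E.IdealSheafData × ℕ)) 𝔟' 𝒟' ∧ StateA 𝔟' H' ℬ' 𝒟' ∧
        ((H'.support : Set E') = e.hom ⁻¹' closure X') ∧ (∀ p ∈ ℬ', (p.1.support : Set E') ⊆ e.hom ⁻¹' B') ∧
        (∀ x : E', e.hom x ∈ B' → ∃ p ∈ ℬ', x ∈ p.1.support) := by
  intro Z' σ X' B' h
  induction h with
  | refl =>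
    refine ⟨𝔟.support.isClosed, E, inferInstance, inferInstance, inferInstance, 𝟙 E, Iso.refl E, 𝔟, 𝔟, [], [],
      IsSepSeq.nil 𝔟 [], StateA.init hE h𝔟 hlp, ?_, fun p hp => by simp at hp, fun x hx => by simp at hx⟩
    rw [𝔟.support.isClosed.closure_eq, Iso.refl_hom, preimage_id']
  | @blowup Z' Z'' σ X' B' _ C τ hτ hreg hsub hBsing _ hnc ih =>
    obtain ⟨hX'c, E', hint, hnoeth, hnoethZ, ρ, e, 𝔟', H', ℬ', 𝒟', hseq, S, hsupp, hbd, hcov⟩ := ih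
    haveI := hint
    haveI := hnoeth
    haveI := hnoethZ
    haveI : IsNoetherian Z'' := isNoetherian_of_isBlowup hτ
    have hclX : closure X' = X' := hX'c.closure_eq
    refine ⟨isClosed_closure, ?_⟩
    by_cases hC0 : C = ⊤
    · /- EMPTY centre: `τ` is an isomorphism, absorbed into `e` -/
      haveI := isIso_of_isBlowup_top hτ hC0
      have hCs : (C.support : Set Z') = ∅ := by
        rw [hC0, Scheme.IdealSheafData.support_top]; rfl
      refine ⟨E', hint, hnoeth, inferInstance, ρ, e ≪≫ (asIso τ).symm, 𝔟', H', ℬ', 𝒟', hseq, S, ?_, fun p hp => ?_,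
        fun x hx => ?_⟩
      · rw [hsupp, hCs, Set.sdiff_empty, hclX, closure_closure, (hX'c.preimage τ.continuous).closure_eq, Iso.trans_hom,
          Iso.symm_hom, asIso_inv, preimage_comp', preimage_inv_preimage]
      · rw [hCs, Set.union_empty, Iso.trans_hom, Iso.symm_hom, asIso_inv, preimage_comp', preimage_inv_preimage]
        exact hbd p hp
      · refine hcov x ?_
        have hx' : x ∈ ⇑(e ≪≫ (asIso τ).symm).hom ⁻¹' (⇑τ ⁻¹' (B' ∪ (C.support : Set Z'))) := hx
        rw [hCs, Set.union_empty, Iso.trans_hom, Iso.symm_hom, asIso_inv, preimage_comp', preimage_inv_preimage] at hx'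
        exact hx'
    · /- NON-EMPTY centre: re-sequence along the pieces of `e^* C` on `E'` -/
      have hCne : (C.support : Set Z').Nonempty := by
        rw [Set.nonempty_iff_ne_empty]
        intro h0
        apply hC0
        rw [← Scheme.IdealSheafData.support_eq_bot_iff]
        exact Closeds.ext h0
      -- the centre read on `E'`, and the blow-up `τ ≫ e⁻¹` along it
      have hC₀reg : Scheme.IsRegular (C.comap e.hom).subscheme := isRegular_subscheme_comap_of_isOpenImmersion e.hom C hreg
      have hτ₀ : IsBlowup (τ ≫ e.inv) (C.comap e.hom) := by
        have h := hτ.comp_iso e.symm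
        rwa [Iso.symm_hom, Iso.symm_inv] at h
      have hC₀s : ((C.comap e.hom).support : Set E') = e.hom ⁻¹' C.support := by
        rw [support_comap]; rfl
      have hCX : (C.support : Set Z') ⊆ closure X' := by
        intro y hy
        have h : y ∈ ((vanishingIdeal (⟨closure X', isClosed_closure⟩ : Closeds Z')).support : Set Z') :=
          support_antitone hsub hy
        rwa [Scheme.IdealSheafData.coe_support_vanishingIdeal] at h
      have hC₀D : ((C.comap e.hom).support : Set E') ⊆ H'.support := by
        rw [hC₀s, hsupp]; exact Set.preimage_mono hCX
      -- the pieces of the centre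
      have hP : IsPiecePartition (C.comap e.hom) (Kollar2007.boundaryPieces (C.comap e.hom)) :=
        isPiecePartition_boundaryPieces_of_isRegular hC₀reg
      have hne : Kollar2007.boundaryPieces (C.comap e.hom) ≠ [] := by
        intro h0
        rw [boundaryPieces_eq_nil_iff] at h0
        obtain ⟨y, hy⟩ := hCne
        have h : e.inv y ∈ ((C.comap e.hom).support : Set E') := by
          rw [hC₀s, Set.mem_preimage, hom_inv_apply]; exact hy
        rw [h0, Scheme.IdealSheafData.support_top] at h
        exact h
      -- the born traces have snc with the centre (P3 on `Z'`, pushed through `e`)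
      have hsncC : HasSNCWith (boundaryOf ℬ') (C.comap e.hom) :=
        hasSNCWith_comap_of_isNormalCrossingWith e S.sncB
          (fun K hK => by obtain ⟨p, hp, rfl⟩ := List.mem_map.mp hK; exact hbd p hp)
          (eq_vanishingIdeal_support_of_isRegular C hreg) hnc
      -- the reduced host ideal read through `e`
      have hDcomap : (vanishingIdeal (⟨closure X', isClosed_closure⟩ : Closeds Z')).comap e.hom = vanishingIdeal H'.support := by
        rw [comap_hom_vanishingIdeal]; congr 1; exact (Closeds.ext hsupp).symm
      -- ORD2 at every point of the centre, from CJS's «singular OR on the boundary»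
      have hord2 : ∀ z ∈ ((C.comap e.hom).support : Set E'), (2 : ℕ∞) ≤ idealOrder 𝔟' z := by
        intro z hzC₀
        have hzC : e.hom z ∈ (C.support : Set Z') := by rwa [hC₀s] at hzC₀
        refine S.ord2_of_bsing (hC₀D hzC₀) ?_
        rcases hBsing (e.hom z) hzC with h | h
        · left
          intro hreg'
          apply h
          let φ : Z'.presheaf.stalk (e.hom z) ≃+* E'.presheaf.stalk z := (asIso (e.hom.stalkMap z)).commRingCatIsoToRingEquiv
          have hφ : (φ : Z'.presheaf.stalk (e.hom z) →+* E'.presheaf.stalk z) = (e.hom.stalkMap z).hom := rfl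
          have hJ : stalkIdeal (vanishingIdeal H'.support) z =
              (stalkIdeal (vanishingIdeal (⟨closure X', isClosed_closure⟩ : Closeds Z')) (e.hom z)).map
                (φ : Z'.presheaf.stalk (e.hom z) →+* E'.presheaf.stalk z) := by
            rw [← hDcomap, stalkIdeal_comap_eq_map, hφ]
          haveI := hreg'
          exact IsRegularLocalRing.of_ringEquiv (Ideal.quotientEquiv _ _ φ hJ).symm
        · exact Or.inr (hcov z h)
      -- the centre data of every piece
      have hΓ : ∀ Z ∈ Kollar2007.boundaryPieces (C.comap e.hom), CentreA 𝔟' H' ℬ' Z := fun Z hZ =>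
        { irred := isIrreducible_of_mem_boundaryPieces hZ
          regZ := isRegular_subscheme_vanishingIdeal_piece hC₀reg hP hZ
          subZ := fun x hx => hC₀D (hP.subset hZ hx)
          sncZ := hsncC.centrePiece hP hZ
          ord2 := fun z hz => hord2 z (hP.subset hZ hz) }
      -- the pieces loop
      obtain ⟨hint'', hnoeth'', 𝔟'', H'', ℬ'', 𝒟'', hseq', S', hsupp', hbd', hcov'⟩ :=
        pieces_loop S hseq hC₀reg hne hP hΓ (B₀ := e.hom ⁻¹' (B' ∪ (C.support : Set Z')))
          (fun p hp => (hbd p hp).trans (Set.preimage_mono Set.subset_union_left))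
          (by rw [hC₀s]; exact Set.preimage_mono Set.subset_union_right)
          (fun x hx => by
            rcases hx with hx | hx
            · exact Or.inl (hcov x hx)
            · right; rwa [hC₀s])
          hτ₀
      refine ⟨Z'', hint'', hnoeth'', inferInstance, (τ ≫ e.inv) ≫ ρ, Iso.refl Z'', 𝔟'', H'', ℬ'', 𝒟'', hseq', S', ?_,
        fun p hp => ?_, fun x hx => hcov' x ?_⟩
      · rw [hsupp', hsupp, hC₀s, ← Set.preimage_sdiff, preimage_comp', preimage_inv_preimage_hom, hclX, closure_closure,
          Iso.refl_hom, preimage_id']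
      · rw [Iso.refl_hom, preimage_id']
        refine (hbd' p hp).trans ?_
        rw [preimage_comp', preimage_inv_preimage_hom]
      · rw [Iso.refl_hom] at hx
        rw [Set.mem_preimage, Scheme.Hom.comp_apply, hom_inv_apply]
        simpa using hx

end SepCJS

/-! ## The Phase-A interface by name -/

namespace SepPhaseA

open SepCJS DepthTargets

/-- **T6-E2 PHASE A «CJS ⇒ IsSepSeq»** (res-L1-w52-stub-1's interface VERBATIM, 10:24:27Z): modulo CJS (F-32bR, `B = ∅`), a
non-zero locally principal `𝔟` on an integral Noetherian regular excellent scheme of dimension three is carried by a weight-one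
sequence `IsSepSeq ρ 𝔟 [] (monomialIdeal 𝒮) 𝒟` to an integral Noetherian regular `E'` on which `𝒮` is drawn from an snc
list `𝓔₀` containing every trace of `𝒟`, every member of `𝒮` having preconnected support — the MID state from which
Phase B «PEEL-ALL» reaches `EndSep`.  Route: `X = Supp 𝔟` is closed, `≠ E`, of dimension `≤ 2`
(`Literature.Topology.topologicalKrullDim_lt_of_isClosed_ssubset`); CJS (`.of_isClosed`); `SepCJS.cjs_transport`;
`SepCJS.StateA.endData`. [cite: CossartJannsenSaito2020, Thm. 1.4, Thm. 6.9 (a), p. 7] [cite: Kollar2007, (3.111) Steps 1–3] -/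
theorem phaseA (hCJS : CossartJannsenSaito2020EmbeddedSequenceB.{u}) (E : Scheme.{u}) [IsIntegral E] [IsNoetherian E]
    (hreg : Scheme.IsRegular E) (hexc : Scheme.IsExcellent E) (hdim : topologicalKrullDim E = 3) (𝔟 : E.IdealSheafData)
    (h𝔟 : 𝔟 ≠ ⊥) (hlp : IsLocallyPrincipal 𝔟) :
    ∃ (E' : Scheme.{u}) (ρ : E' ⟶ E) (_ : IsIntegral E') (_ : IsNoetherian E') (𝓔₀ : List E'.IdealSheafData)
      (𝒮 𝒟 : List (E'.IdealSheafData × ℕ)),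
      Scheme.IsRegular E' ∧ HasSNC 𝓔₀ ∧ (∀ p ∈ 𝒮, p.1 ∈ 𝓔₀ ∧ _root_.IsPreconnected (p.1.support : Set E')) ∧
      (∀ D ∈ boundaryOf 𝒟, D ∈ 𝓔₀ ∨ D = ⊤) ∧
      IsSepSeq ρ 𝔟 ([] : List (E.IdealSheafData × ℕ)) (monomialIdeal 𝒮) 𝒟 := by
  -- `X = Supp 𝔟` is closed, `≠ E`, of dimension `≤ 2`
  set X : Set E := (𝔟.support : Set E) with hXdef
  have hXc : IsClosed X := 𝔟.support.isClosed
  have hXne : X ≠ Set.univ := fun hX =>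
    not_mem_support_genericPoint h𝔟 (show genericPoint E ∈ X from hX ▸ Set.mem_univ _)
  have hdimX : topologicalKrullDim X ≤ 2 := by
    have hlt := Literature.Topology.topologicalKrullDim_lt_of_isClosed_ssubset hXc hXne (2 + 1)
      (by rw [hdim]; exact_mod_cast (by norm_num : (3 : ℕ) < 2 + 1 + 1))
    rw [Nat.cast_add_one] at hlt
    exact_mod_cast (ENat.WithBot.lt_add_one_iff.mp hlt)
  -- CJS: the `𝓑`-permissible sequence over `X` and its end clauses
  obtain ⟨Z₁, π, X₁, B₁, hT, -, -, -, -, hX₁, -, -, htr⟩ := hCJS.of_isClosed E hreg hexc X hXc hdimX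
  -- transport and END
  obtain ⟨hX₁c, E', hint, hnoeth, hnoethZ, ρ, e, 𝔟', H', ℬ', 𝒟', hseq, S, hsupp, hbd, -⟩ :=
    SepCJS.cjs_transport hreg 𝔟 h𝔟 hlp hT
  haveI := hint
  haveI := hnoeth
  haveI := hnoethZ
  obtain ⟨𝓔₀, 𝒮, hsnc, hmem, hbd𝒟, hmon⟩ := S.endData e hX₁c hX₁ htr hsupp hbd
  refine ⟨E', ρ, hint, hnoeth, 𝓔₀, 𝒮, 𝒟', S.regW, hsnc, hmem, hbd𝒟, ?_⟩
  rw [hmon]; exact hseq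

end SepPhaseA

end Summit.ResolutionOfSingularities.ResolutionOfSingularities.Theorems

end
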